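import Mathlib
import Literature.MathematicalPhysics.QuantumFieldTheory.Balaban1983to89.B5Blocks16

/-!
# `Q_k G Q_k^*` — Bałaban's block-averaged propagator of [Bałaban 1984, (1.18), (1.69)–(1.71)] at
# `U = 1` on a finite torus: `Q_k^*Q_k` is the fibre term of (1.73), `𝒟_a ⪰ a·Q_k^*Q_k` (p.30),
# `‖Q_k G Q_k^*‖ = a⁻¹` exactly, and King's effective operator (2.14) built for `Δ_a` is `⪰ 0`

WHAT IS PRINTED. Bałaban, *Propagators and renormalization transformations for lattice gauge
theories. I*, CMP 95 (1984) (renders of pp. 29–31 read): p.29 «The integral (1.47) can be written in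
the following way ((ST)^k exp(−S))(B) = z′^{(k)}|det(Δ↾_{N(Q_k)})| ∫dA δ(B − Q_kA)δ_R(∂^*A)
· exp[−½⟨∂A, ∂A⟩ − ½‖R∂^*A‖² − ½a‖B − Q_kA‖²]. (1.68) The additional terms vanish because of the
delta-functions. The quadratic form in the fields A in the exponential is equal to
⟨A, Δ_aA⟩ = ⟨A, ∂^*∂A⟩ + ⟨A, ∂R∂^*A⟩ + a⟨A, Q^*QA⟩ = ⟨A, ΔA⟩ − ⟨A, ∂P∂^*A⟩ + a⟨A, Q^*QA⟩, (1.69)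
Δ = ∂^*∂ + ∂∂^*, R = I − P,»; p.30 «At first let us prove that Δ_a is a positive operator. Of course
it is a symmetric operator and it is non-negative as a sum of two non-negative operators Δ − ∂P∂^*
and aQ^*Q, a > 0.», «Δ_a⁻¹ = G_k, or simply G. (1.71)», «a⟨1, Q^*QA_μ⟩ = a⟨1, A_μ⟩ = ⟨1, J_μ⟩»
(in (1.74)); p.31 «GJ = GJ′ + a⁻¹J₀. (1.82)». The averaging `Q_k` is (1.18) p.20 (tree:
`B5Block118.QvOp`, its symbol (1.61) p.28: `B5Block118.dft_QvOp`, fibre `B5Prop11Inverse.Qv`).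
King, *The U(1) Higgs model. I*, CMP 102 (1986) (render of p.653 read): «Q_kA_μ(y) = L^{−kd}
Σ_{x∈B^k(y)} A_μ(x), (2.10)», «G^ε_k(Ω, A) = (−Δ^{ε,Ω}_A + m² + a_k(L^kε)^{−2}Q_k(A)^*Q_k(A))^{−1},
(2.13) where a_k = a(1 − L^{−2})(1 − L^{−2k})^{−1} and a is O(1). The effective Laplacian of the
average scalar field on Ω^{(k)} is Δ^{(k),L^kε}(Ω, A) = a_k(L^kε)^{−2}I − a_k²(L^kε)^{−4}Q_k(A)
G^ε_k(Ω, A)Q_k(A)^*. (2.14)», «All the corresponding expressions for the vector field are obtained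
from (2.13)–(2.17) by setting m² = μ₀², N = d and A = 0.»

WHAT IS TYPED — everything at `U = 1`, ONE level `n = L^k = η⁻¹`, on the finite torus
`T_η = Tor (fine n M)` over the unit torus `Tor M`, in the `ℓ²`-matrix language of the pass-5 leaves
(`B5Prop11Inverse.calDa` = `𝒟_a` = `F^*[D_a-blocks]F`, `calG` = `𝒢` = `𝒟_a⁻¹`), unit-lattice
variables (King's factors `(L^kε)^{-2}`, `(L^kε)^{-4}` are thereby absorbed):
* §2 `Pk` = `Q_k^*Q_k` = `n^d·QvOpᴴQvOp` (`Q_k^* = η^{-d}Q_kᵀ`, the adjoint for `⟨·,·⟩_η = η^dΣ` vs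
  `⟨·,·⟩₁ = Σ`); `covB` = `Q_kGQ_k^*` = `n^d·QvOp 𝒢 QvOpᴴ`; `effOp` = `a·1 − a²·covB`.
* §3 (1.61) as matrix identities: `dftV_mul_QvOp` (`F₁Q_k = ŴF_η`), `QvOp_eq`, `WhatH_mul_What`,
  **`Pk_eq`**: `Q_k^*Q_k = F_η^*[diag_q Wq_q^*Wq_q]F_η` with `Wq_q` = the fibre `Qv` (`q ≠ 0`) /
  `Qv₀` (`q = 0`) — the `aQ^*Q` of (1.69) IS, coset by coset, the fibre term `aQ^*Q` of (1.73).
* §4 the p.30 sentence as a LÖWNER INEQUALITY: `DaBlocks_sub_posSemidef` (fibrewise, from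
  `B5Prop11Lower.Da_eq_three`, `Nmat_posSemidef`, `dRd_posSemidef`; `Δ ⪰ 0` at `p′ = 0`) and
  **`calDa_sub_smul_Pk_posSemidef`**: `𝒟_a − a·Q_k^*Q_k ⪰ 0`.
* §5 **`opNorm_covB_le`**: `‖Q_kGQ_k^*‖ ≤ a⁻¹` (variational: `v = GQ_k^*w`, `⟨v,𝒟_av⟩ ≥ a‖Q_kv‖²`,
  `⟨v,𝒟_av⟩ = ⟨Q_kv, w⟩`, Cauchy–Schwarz), `covB_posSemidef`, `covB_isHermitian`.
* §6 zero modes: `QvOp_mulVec_const`, `QvOp_colSum` (column sums `η^d`, by `B5Blocks16.sum_blocks`),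
  `QvOp_conjTranspose_mulVec_const` (`Q_k^*` fixes constants, (1.74)), `calG_mulVec_const`
  ((1.82): `Gc = a⁻¹c`), `covB_mulVec_const` (`Q_kGQ_k^*c = a⁻¹c`), **`opNorm_covB_eq`**:
  `‖Q_kGQ_k^*‖ = a⁻¹` (`d ≥ 1`); `effOp_posSemidef`, `smul_one_sub_effOp_posSemidef`
  (`0 ⪯ a − a²Q_kGQ_k^* ⪯ a`), `effOp_mulVec_const` (the constants are zero modes).
* §7 King's mechanism (2.13) → (2.14) written for `Δ_a`: `Amin` (`A_B = a·GQ_k^*B`),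
  `form_calDa_sub_Amin`, **`completeSquare`**:
  `½η^d·A^*𝒟_aA − (a/2)((Q_kA)^*B + B^*Q_kA) + (a/2)B^*B = ½B^*(a − a²Q_kGQ_k^*)B
   + ½η^d·(A − A_B)^*𝒟_a(A − A_B)`, and `half_form_effOp_le` (the lower bound, by `𝒟_a ⪰ 0`).

WHY THIS LEAF (lineage t4-ne2-p1, technique «lift King's effective-Laplacian layer §4/(2.14) to
Bałaban's vector layer via the B5 §1 propagator representations»). The companion leaf
`B5G183RateUnitTower` averages the Landau-gauge `𝒢` with KING's componentwise `Q_k` (2.10)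
(`Qtow`, `unitCov`); for that averaging the (2.14) transform `a − a²c_k` is NOT positive (numerical
record in that leaf's §12 docstring: `‖c_k‖ > a⁻¹` generically). With Bałaban's own averaging `Q_k`
(1.18) — the one inside `Δ_a` — the p.30 decomposition is a Löwner inequality `𝒟_a ⪰ a·Q_k^*Q_k`,
which forces `‖Q_kGQ_k^*‖ = a⁻¹` exactly (attained on the constants, (1.82)) and makes King's
effective operator for `Δ_a` positive semidefinite with the constants in its kernel, at every level,
with NO dependence on `k`, `L`, the torus or `d` — the uniform-in-`k` input a rate statement needs.

NOT CLAIMED. (i) Bałaban's transformation (1.68) carries `δ(B − Q_kA)δ_R(∂^*A)`; the `a`-term is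
auxiliary there («The additional terms vanish because of the delta-functions»). `effOp` is King's
SOFT-averaging object (Gaussian weight `exp[−½a‖B − Q_kA‖²]` in place of the δ-function) built on
Bałaban's `Δ_a`; it is NOT Bałaban's `Δ_k` of (1.65), and no relation between `effOp` and
(1.65)–(1.67) is typed. (ii) No `η`-rate / `k → ∞` statement for `Q_kGQ_k^*` (the tower laws of
`B5G183RateUnitTower` are for King's averaging (2.10); a two-level law for `QvOp` is not typed).
(iii) `U = 1` only — no background field, so (B), (B^μ), BetaPertH neither enter nor are
discharged; finite torus only; nothing here is a statement about continuum Yang–Mills on `T⁴`,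
infinite volume, or `Summit.QuantumFields`. (iv) `completeSquare` is an algebraic identity of
finite-dimensional quadratic forms; no Gaussian integral is formalised. Constants-free: every
bound is `a⁻¹` / `a` on the nose.
-/

noncomputable section

namespace Literature.MathematicalPhysics.QuantumFieldTheory.Balaban1983to89.B5QGQ171Unit

open scoped BigOperators Matrix ComplexConjugate ComplexOrder Matrix.Norms.L2Operator
open Finset Complex
open Literature.MathematicalPhysics.QuantumFieldTheory.Balaban1983to89.B4Strip
open Literature.MathematicalPhysics.QuantumFieldTheory.Balaban1983to89.B5Prop11Leaves
open Literature.MathematicalPhysics.QuantumFieldTheory.Balaban1983to89.B5Prop11Bound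
open Literature.MathematicalPhysics.QuantumFieldTheory.Balaban1983to89.B5Prop11Fiber
open Literature.MathematicalPhysics.QuantumFieldTheory.Balaban1983to89.B5Prop11Plancherel
open Literature.MathematicalPhysics.QuantumFieldTheory.Balaban1983to89.B5Prop11Inverse
open Literature.MathematicalPhysics.QuantumFieldTheory.Balaban1983to89.B5Prop11Lower
open Literature.MathematicalPhysics.QuantumFieldTheory.Balaban1983to89.B5Action121
open Literature.MathematicalPhysics.QuantumFieldTheory.Balaban1983to89.B5Block118
open Literature.MathematicalPhysics.QuantumFieldTheory.Balaban1983to89.B5Blocks16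

/-! ## §1 Tools -/

section Tools

variable {m : Type*} [Fintype m] [DecidableEq m]

/-- `‖X‖ ≤ c` for a positive semidefinite `X` whose form is bounded by `c‖w‖²` (Gram factor). [folklore] -/
private theorem opNorm_le_of_re_form_le {X : Matrix m m ℂ} (hX : X.PosSemidef) {c : ℝ} (hc : 0 ≤ c)
    (h : ∀ w : m → ℂ, (star w ⬝ᵥ (X *ᵥ w)).re ≤ c * nsq w) : ‖X‖ ≤ c := by
  obtain ⟨B, hB⟩ := exists_gram hX
  have key : ∀ w : m → ℂ, nsq (B *ᵥ w) ≤ c * nsq w := by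
    intro w
    have h1 : star w ⬝ᵥ (X *ᵥ w) = ((nsq (B *ᵥ w) : ℝ) : ℂ) := by
      rw [hB, ← Matrix.mulVec_mulVec, Matrix.dotProduct_mulVec, Matrix.vecMul_conjTranspose,
        star_star, star_dotProduct_self]
    have h2 := h w
    rw [h1, Complex.ofReal_re] at h2
    exact h2
  have hB' : ‖B‖ ≤ Real.sqrt c := by
    refine opNorm_le_of_sq_le B (Real.sqrt_nonneg c) fun x => ?_
    have hx := key x
    rw [Real.sq_sqrt hc]
    simpa [nsq, Matrix.mulVec, dotProduct] using hx
  calc ‖X‖ = ‖Bᴴ * B‖ := by rw [hB]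
    _ = ‖B‖ * ‖B‖ := Matrix.l2_opNorm_conjTranspose_mul_self B
    _ ≤ Real.sqrt c * Real.sqrt c :=
        mul_le_mul hB' hB' (norm_nonneg _) (Real.sqrt_nonneg _)
    _ = c := Real.mul_self_sqrt hc

omit [DecidableEq m] in
/-- Löwner order on forms: `D − E ≥ 0 ⇒ Re(v^*Ev) ≤ Re(v^*Dv)`. [folklore] -/
private theorem re_form_le_of_sub_posSemidef {D E : Matrix m m ℂ} (h : (D - E).PosSemidef)
    (v : m → ℂ) : (star v ⬝ᵥ (E *ᵥ v)).re ≤ (star v ⬝ᵥ (D *ᵥ v)).re := by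
  have h0 := form_re_nonneg_of_posSemidef h v
  rw [Matrix.sub_mulVec, dotProduct_sub, Complex.sub_re] at h0
  linarith

omit [DecidableEq m] in
/-- `r • X ≥ 0` for real `r ≥ 0` and `X ≥ 0`. [folklore] -/
private theorem posSemidef_real_smul {X : Matrix m m ℂ} (hX : X.PosSemidef) {r : ℝ} (hr : 0 ≤ r) :
    ((r : ℂ) • X).PosSemidef := by
  classical
  obtain ⟨B, hB⟩ := exists_gram hX
  rw [hB]
  exact smul_gram_posSemidef r hr B

end Tools

/-! ## §2 The objects at one level `n = L^k = η⁻¹` -/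

section Objects

variable {d : ℕ} (n : ℕ) [NeZero n] (hn : 1 ≤ n) (M : Fin d → ℕ) [hM : ∀ μ, NeZero (M μ)]
  (a : ℝ) (ha : 0 < a)

/-- Bałaban's `a⟨A, Q^*QA⟩` term of (1.69) as an `ℓ²` matrix at `U = 1`: `Q_k^*Q_k = η^{-d}·Q_kᵀQ_k`,
i.e. `n^d · QvOpᴴ QvOp` (`Q_k^*` the adjoint for the pairings `⟨·,·⟩_η = η^dΣ`, `⟨·,·⟩₁ = Σ`).
[cite: Balaban1984PropagatorsI, (1.69) p.29] -/
def Pk : Matrix (Tor (fine n M) × Fin d) (Tor (fine n M) × Fin d) ℂ :=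
  ((n : ℂ) ^ d) • ((QvOp n M)ᴴ * QvOp n M)

/-- the AVERAGED PROPAGATOR `Q_k G Q_k^*` («Δ_a⁻¹ = G_k, or simply G. (1.71)») as an `ℓ²` matrix on unit-lattice
vector fields: `n^d · QvOp 𝒢 QvOpᴴ` (b05's `calG` = `𝒢` of (1.83) at `U = 1`).
[cite: Balaban1984PropagatorsI, (1.71) p.30] -/
def covB : Matrix (Tor M × Fin d) (Tor M × Fin d) ℂ :=
  ((n : ℂ) ^ d) • (QvOp n M * calG n hn M a ha * (QvOp n M)ᴴ)

/-- King's EFFECTIVE OPERATOR «a_k(L^kε)^{−2}I − a_k²(L^kε)^{−4}Q_k(A)G^ε_k(Ω,A)Q_k(A)^*. (2.14)» built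
for Bałaban's `Δ_a` (1.69) and `Q_k` (1.18) in unit-lattice variables: `a·1 − a²·Q_k G Q_k^*`.
[cite: King1986, (2.14) p.653] -/
def effOp : Matrix (Tor M × Fin d) (Tor M × Fin d) ℂ :=
  (a : ℂ) • (1 : Matrix (Tor M × Fin d) (Tor M × Fin d) ℂ) - ((a : ℂ) ^ 2) • covB n hn M a ha

/-! ## §3 `Q_k` in momentum space: the block rows `Wq` over the cosets `p = p′ + l` -/

/-- the fibre of `Q_k` over the coarse momentum `p′ ↔ q`, INCLUDING `p′ = 0`:
`(μ; (l, ν)) ↦ δ_{μν} u(p′+l) v_μ(p′+l)` — the symbol of (1.61). [cite: Balaban1984PropagatorsI, (1.61) p.28] -/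
def Wq (q : Tor M) : Matrix (Fin d) ((Fin d → Fin n) × Fin d) ℂ :=
  fun μ i => if i.2 = μ then uSym n i.1 (sOf M q) * vSym n i.1 (sOf M q) μ else 0

/-- at `p′ ≠ 0` the fibre is b05's `Qv` of the concrete fibre datum. [cite: Balaban1984PropagatorsI, (1.61) p.28] -/
theorem Wq_of_ne_zero {q : Tor M} (hq : q ≠ 0) :
    Wq n M q = Qv (balabanFiber n hn a ha (sOf M q) (abs_sOf_le M q) (sOf_ne_zero M hq)) := rfl

omit hM in
/-- at `p′ = 0` the fibre is b05's `Qv₀`. [cite: Balaban1984PropagatorsI, (1.61) p.28] -/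
theorem Wq_zero : Wq n M 0 = Qv₀ (d := d) (fun _ => (0 : Fin n)) := by
  ext μ ⟨k, ν⟩
  simp only [Wq, Qv₀, uSym_sOf_zero, Prod.mk.injEq]
  by_cases hν : ν = μ
  · subst hν
    by_cases hk : k = 0
    · subst hk
      have h0 : vSym n (fun _ => (0 : Fin n)) (0 : Fin d → ℝ) ν = 1 := by
        have h : dSym n (fun _ => (0 : Fin n)) (0 : Fin d → ℝ) ν = 0 := by
          simp [dSym, shiftr]
        simp [vSym, h]
      have h1 : vSym n (0 : Fin d → Fin n) (sOf M (0 : Tor M)) ν = 1 := by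
        rw [sOf_zero]; exact h0
      rw [if_pos rfl, if_pos rfl, h1, one_mul, if_pos ⟨rfl, rfl⟩]
    · rw [if_pos rfl, if_neg hk, zero_mul, if_neg (fun h => hk h.1)]
  · rw [if_neg hν, if_neg (fun h => hν h.2)]

/-- `Q_k` in momentum space as ONE matrix: block row `q` is `n^{-d/2}·Wq q` on the coset of `q`, zero
elsewhere. [cite: Balaban1984PropagatorsI, (1.61) p.28] -/
def What : Matrix (Tor M × Fin d) (((Fin d → Fin n) × Fin d) × Tor M) ℂ :=
  fun b I => if I.2 = b.1 then (cQ n M : ℂ) * Wq n M b.1 b.2 I.1 else 0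

omit [NeZero n] in
/-- `(F X)(p, μ) = (F X_μ)(p)` for the componentwise DFT. [folklore] -/
private theorem dftV_mulVec_eq (N : Fin d → ℕ) [∀ μ, NeZero (N μ)] (X : Tor N × Fin d → ℂ)
    (p : Tor N) (μ : Fin d) : (dftV N *ᵥ X) (p, μ) = (dft N *ᵥ comp N X μ) p := by
  simp only [Matrix.mulVec, dotProduct, comp, Fintype.sum_prod_type, dftV_apply, ite_mul,
    zero_mul, Finset.sum_ite_eq, Finset.mem_univ, if_true]

/-- the block-row matrix applied to a momentum-space vector field: only the coset of `q` enters.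
[cite: Balaban1984PropagatorsI, (1.61) p.28] -/
theorem What_submatrix_mulVec (Y : Tor (fine n M) × Fin d → ℂ) (q : Tor M) (μ : Fin d) :
    ((What n M).submatrix id (blockEquiv n M) *ᵥ Y) (q, μ)
      = (cQ n M : ℂ) * ∑ k : Fin d → Fin n,
          uSym n k (sOf M q) * vSym n k (sOf M q) μ * Y (pOf n M (k, q), μ) := by
  simp only [Matrix.mulVec, dotProduct, Matrix.submatrix_apply, id]
  rw [← (blockEquiv n M).symm.sum_comp]
  simp only [Equiv.apply_symm_apply]
  rw [Fintype.sum_prod_type]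
  simp only [What, ite_mul, zero_mul, Finset.sum_ite_eq', Finset.mem_univ, if_true]
  rw [Fintype.sum_prod_type, Finset.mul_sum]
  refine Finset.sum_congr rfl fun k _ => ?_
  rw [Finset.sum_eq_single_of_mem μ (Finset.mem_univ _) ?_]
  · simp only [Wq, if_true, blockEquiv_symm_apply, emb_eq]
    ring
  · intro ν _ hν
    simp only [Wq, if_neg hν, mul_zero, zero_mul]

/-- (1.61) as a MATRIX identity: `F₁ Q_k = Ŵ F_η` (from b05's `dft_QvOp`). [cite: Balaban1984PropagatorsI, (1.61) p.28] -/
theorem dftV_mul_QvOp :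
    dftV M * QvOp n M = (What n M).submatrix id (blockEquiv n M) * dftV (fine n M) := by
  refine Matrix.toLin'.injective (LinearMap.ext fun A => ?_)
  simp only [Matrix.toLin'_apply]
  funext ⟨q, μ⟩
  rw [← Matrix.mulVec_mulVec, ← Matrix.mulVec_mulVec, dftV_mulVec_eq, dft_QvOp,
    What_submatrix_mulVec]
  congr 1
  refine Finset.sum_congr rfl fun k _ => ?_
  rw [dftV_mulVec_eq]

/-- `Q_k = F₁^* Ŵ F_η`. [cite: Balaban1984PropagatorsI, (1.61) p.28] -/
theorem QvOp_eq :
    QvOp n M = star (dftV M) * ((What n M).submatrix id (blockEquiv n M)) * dftV (fine n M) := by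
  calc QvOp n M = (star (dftV M) * dftV M) * QvOp n M := by rw [star_dftV_mul, Matrix.one_mul]
    _ = star (dftV M) * (dftV M * QvOp n M) := by rw [Matrix.mul_assoc]
    _ = star (dftV M) * ((What n M).submatrix id (blockEquiv n M) * dftV (fine n M)) := by
          rw [dftV_mul_QvOp]
    _ = _ := by rw [← Matrix.mul_assoc]

/-- `Ŵ^*Ŵ = n^{-d}·diag_q(Wq_q^* Wq_q)` (block rows on disjoint cosets). [cite: Balaban1984PropagatorsI, (1.61) p.28] -/
theorem WhatH_mul_What :
    (What n M)ᴴ * What n M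
      = ((cQ n M : ℂ) ^ 2) • Matrix.blockDiagonal (fun q => (Wq n M q)ᴴ * Wq n M q) := by
  ext I J
  rw [Matrix.mul_apply, Fintype.sum_prod_type, Matrix.smul_apply, Matrix.blockDiagonal_apply,
    smul_eq_mul]
  simp only [Matrix.conjTranspose_apply, What]
  have hc : star (cQ n M : ℂ) = (cQ n M : ℂ) := by
    rw [Complex.star_def, Complex.conj_ofReal]
  by_cases hIJ : I.2 = J.2
  · rw [if_pos hIJ, Matrix.mul_apply, Finset.mul_sum,
      Finset.sum_eq_single_of_mem I.2 (Finset.mem_univ _) ?_]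
    · refine Finset.sum_congr rfl fun μ _ => ?_
      rw [if_pos rfl, if_pos hIJ.symm, Matrix.conjTranspose_apply, star_mul', hc]
      ring
    · intro q _ hq
      refine Finset.sum_eq_zero fun μ _ => ?_
      rw [if_neg (Ne.symm hq), star_zero, zero_mul]
  · rw [if_neg hIJ, mul_zero]
    refine Finset.sum_eq_zero fun q _ => Finset.sum_eq_zero fun μ _ => ?_
    by_cases h1 : I.2 = q
    · have h2 : ¬ J.2 = q := fun h => hIJ (h1.trans h.symm)
      rw [if_neg h2, mul_zero]
    · rw [if_neg h1, star_zero, zero_mul]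

/-- **`Q_k^*Q_k` IS BLOCK DIAGONAL IN MOMENTUM SPACE with blocks `Wq_q^*Wq_q`** — the operator `Q^*Q` of
(1.69) is b05's fibre matrix `Qvᴴ Qv` of (1.73) on every coset, `p′ = 0` included.
[cite: Balaban1984PropagatorsI, (1.69) p.29, (1.73) p.30 (matrix identity ours)] -/
theorem Pk_eq :
    Pk n M = star (dftV (fine n M))
      * (Matrix.blockDiagonal (fun q => (Wq n M q)ᴴ * Wq n M q)).submatrix
          (blockEquiv n M) (blockEquiv n M)
      * dftV (fine n M) := by
  have hU : dftV M * star (dftV M) = 1 := dftV_mul_star M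
  have hncQ : ((n : ℂ) ^ d) * (cQ n M : ℂ) ^ 2 = 1 := by
    rw [cQ_eq]
    have hn0 : (0 : ℝ) < (n : ℝ) ^ d := pow_pos (by exact_mod_cast Nat.pos_of_ne_zero (NeZero.ne n)) d
    have h1 : ((Real.sqrt ((n : ℝ) ^ d))⁻¹) ^ 2 = ((n : ℝ) ^ d)⁻¹ := by
      rw [inv_pow, Real.sq_sqrt hn0.le]
    have h2 : ((n : ℂ) ^ d) = (((n : ℝ) ^ d : ℝ) : ℂ) := by push_cast; rfl
    rw [← Complex.ofReal_pow, h1, h2, ← Complex.ofReal_mul, mul_inv_cancel₀ hn0.ne',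
      Complex.ofReal_one]
  set W := (What n M).submatrix id (blockEquiv n M) with hW
  have hQ : QvOp n M = star (dftV M) * W * dftV (fine n M) := QvOp_eq n M
  have hQH : (QvOp n M)ᴴ = star (dftV (fine n M)) * Wᴴ * dftV M := by
    rw [hQ, Matrix.conjTranspose_mul, Matrix.conjTranspose_mul, Matrix.star_eq_conjTranspose,
      Matrix.star_eq_conjTranspose, Matrix.conjTranspose_conjTranspose, Matrix.mul_assoc]
  have hWW : Wᴴ * W = ((cQ n M : ℂ) ^ 2) •
      (Matrix.blockDiagonal (fun q => (Wq n M q)ᴴ * Wq n M q)).submatrix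
        (blockEquiv n M) (blockEquiv n M) := by
    rw [hW, Matrix.conjTranspose_submatrix, ← Matrix.submatrix_mul _ _ _ id _
      Function.bijective_id, WhatH_mul_What, Matrix.submatrix_smul]
    rfl
  rw [Pk, hQH, hQ]
  have e1 : star (dftV (fine n M)) * Wᴴ * dftV M * (star (dftV M) * W * dftV (fine n M))
      = star (dftV (fine n M)) * (Wᴴ * (dftV M * star (dftV M)) * W) * dftV (fine n M) := by
    simp only [Matrix.mul_assoc]
  rw [e1, hU, Matrix.mul_one, hWW, Matrix.mul_smul, Matrix.smul_mul, smul_smul, hncQ, one_smul]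

/-! ## §4 «Δ_a … non-negative as a sum of two non-negative operators Δ − ∂P∂* and aQ*Q»:
`𝒟_a − a Q_k^*Q_k ≥ 0` -/

/-- fibrewise: `D_a(p′) − a·Qv^*Qv ≥ 0` («it is non-negative as a sum of two non-negative operators
`Δ − ∂P∂^*` and `aQ^*Q`, `a > 0`» — here the first summand, b05's `Nmat + ∂(1−P)∂^*` / `Δ` at `p′ = 0`).
[cite: Balaban1984PropagatorsI, p.30] -/
theorem DaBlocks_sub_posSemidef (q : Tor M) :
    (DaBlocks n hn M a ha q - (a : ℂ) • ((Wq n M q)ᴴ * Wq n M q)).PosSemidef := by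
  by_cases hq : q = 0
  · subst hq
    rw [Wq_zero]
    simp only [DaBlocks, dif_pos, Da₀, add_sub_cancel_right]
    refine Matrix.PosSemidef.diagonal fun i => ?_
    simp only [Pi.zero_apply]
    refine Complex.zero_le_real.mpr ?_
    rw [Delta_eq n i.1 0]
    exact Finset.sum_nonneg fun μ _ => by positivity
  · simp only [DaBlocks, dif_neg hq]
    set F := balabanFiber n hn a ha (sOf M q) (abs_sOf_le M q) (sOf_ne_zero M hq) with hF
    change (Da F - ((F.a : ℂ)) • ((Qv F)ᴴ * Qv F)).PosSemidef
    rw [Da_eq_three, add_sub_cancel_right]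
    exact (Nmat_posSemidef F (fun k => Delta_eq n k _)).add (dRd_posSemidef F)

/-- **`𝒟_a − a·Q_k^*Q_k ≥ 0`** as `ℓ²` matrices («non-negative as a sum of two non-negative operators
`Δ − ∂P∂^*` and `aQ^*Q`»). [cite: Balaban1984PropagatorsI, p.30, (1.69) p.29] -/
theorem calDa_sub_smul_Pk_posSemidef :
    (calDa n hn M a ha - (a : ℂ) • Pk n M).PosSemidef := by
  have hblk : (Matrix.blockDiagonal (DaBlocks n hn M a ha)
      - (a : ℂ) • Matrix.blockDiagonal (fun q => (Wq n M q)ᴴ * Wq n M q)).PosSemidef := by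
    rw [← Matrix.blockDiagonal_smul, ← Matrix.blockDiagonal_sub]
    exact posSemidef_blockDiagonal _ (DaBlocks_sub_posSemidef n hn M a ha)
  have hsub : ((Matrix.blockDiagonal (DaBlocks n hn M a ha)).submatrix
        (blockEquiv n M) (blockEquiv n M)
      - (a : ℂ) • (Matrix.blockDiagonal (fun q => (Wq n M q)ᴴ * Wq n M q)).submatrix
        (blockEquiv n M) (blockEquiv n M)).PosSemidef := by
    have e : (Matrix.blockDiagonal (DaBlocks n hn M a ha)).submatrix
          (blockEquiv n M) (blockEquiv n M)
        - (a : ℂ) • (Matrix.blockDiagonal (fun q => (Wq n M q)ᴴ * Wq n M q)).submatrix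
          (blockEquiv n M) (blockEquiv n M)
        = (Matrix.blockDiagonal (DaBlocks n hn M a ha)
          - (a : ℂ) • Matrix.blockDiagonal (fun q => (Wq n M q)ᴴ * Wq n M q)).submatrix
            (blockEquiv n M) (blockEquiv n M) := rfl
    rw [e]
    exact hblk.submatrix _
  have e : calDa n hn M a ha - (a : ℂ) • Pk n M
      = star (dftV (fine n M))
        * ((Matrix.blockDiagonal (DaBlocks n hn M a ha)).submatrix
            (blockEquiv n M) (blockEquiv n M)
          - (a : ℂ) • (Matrix.blockDiagonal (fun q => (Wq n M q)ᴴ * Wq n M q)).submatrix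
            (blockEquiv n M) (blockEquiv n M))
        * dftV (fine n M) := by
    rw [Matrix.mul_sub, Matrix.sub_mul, Matrix.mul_smul, Matrix.smul_mul, calDa, calDahat,
      Matrix.reindex_symm, Matrix.reindex_apply, Equiv.symm_symm, Pk_eq]
  rw [e, Matrix.star_eq_conjTranspose]
  exact hsub.conjTranspose_mul_mul_same _

/-! ## §5 `‖Q_k 𝒢 Q_k^*‖ ≤ a⁻¹` -/

/-- `Q_k G Q_k^* ≥ 0`. [cite: Balaban1984PropagatorsI, (1.71) p.30] -/
theorem covB_posSemidef : (covB n hn M a ha).PosSemidef := by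
  have h := (calG_posSemidef n hn M a ha).mul_mul_conjTranspose_same (QvOp n M)
  have hr : (0 : ℝ) ≤ (n : ℝ) ^ d := by positivity
  have e : ((n : ℂ) ^ d) = (((n : ℝ) ^ d : ℝ) : ℂ) := by push_cast; rfl
  rw [covB, e]
  exact posSemidef_real_smul h hr

/-- `Q_k G Q_k^*` is Hermitian. [cite: Balaban1984PropagatorsI, (1.71) p.30] -/
theorem covB_isHermitian : (covB n hn M a ha).IsHermitian :=
  (covB_posSemidef n hn M a ha).isHermitian

/-- the variational bound `Re⟨w, Q_kGQ_k^* w⟩ ≤ a⁻¹‖w‖²`: with `v = GQ_k^*w`, `⟨v, 𝒟_av⟩ ≥ a‖Q_kv‖²` and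
`⟨v, 𝒟_av⟩ = ⟨Q_kv, w⟩ ≤ ‖Q_kv‖‖w‖`. [cite: Balaban1984PropagatorsI, p.30, (1.71) p.30 (bound ours)] -/
theorem re_form_covB_le (w : Tor M × Fin d → ℂ) :
    (star w ⬝ᵥ (covB n hn M a ha *ᵥ w)).re ≤ a⁻¹ * nsq w := by
  set Q := QvOp n M with hQdef
  set G := calG n hn M a ha with hGdef
  set D := calDa n hn M a ha with hDdef
  set v : Tor (fine n M) × Fin d → ℂ := G *ᵥ (Qᴴ *ᵥ w) with hv
  have hN : (0 : ℝ) < (n : ℝ) ^ d := pow_pos (by exact_mod_cast Nat.pos_of_ne_zero (NeZero.ne n)) d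
  have eN : ((n : ℂ) ^ d) = (((n : ℝ) ^ d : ℝ) : ℂ) := by push_cast; rfl
  have hDv : D *ᵥ v = Qᴴ *ᵥ w := by
    rw [hv, Matrix.mulVec_mulVec, hDdef, hGdef, calDa_mul_calG, Matrix.one_mulVec]
  have hDH : Dᴴ = D := (calDa_isHermitian n hn M a ha).eq
  have hDpsd : D.PosSemidef := calDa_posSemidef n hn M a ha
  -- the form of `covB` through `v`
  have hwQ : star w ᵥ* Q = star (Qᴴ *ᵥ w) := by
    rw [Matrix.star_mulVec, Matrix.conjTranspose_conjTranspose]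
  have hform : star w ⬝ᵥ (Q *ᵥ v) = star v ⬝ᵥ (D *ᵥ v) := by
    rw [Matrix.dotProduct_mulVec, hwQ, ← hDv, Matrix.star_mulVec, hDH, ← Matrix.dotProduct_mulVec]
  have h1 : star w ⬝ᵥ (covB n hn M a ha *ᵥ w) = ((n : ℂ) ^ d) * (star v ⬝ᵥ (D *ᵥ v)) := by
    rw [covB, Matrix.smul_mulVec, dotProduct_smul, smul_eq_mul, ← hform, ← hQdef, ← hGdef, hv,
      ← Matrix.mulVec_mulVec, ← Matrix.mulVec_mulVec]
  set t : ℝ := (star v ⬝ᵥ (D *ᵥ v)).re with htdef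
  have ht0 : 0 ≤ t := form_re_nonneg_of_posSemidef hDpsd v
  -- Löwner: `a n^d ‖Qv‖² ≤ t`
  have hPk : star v ⬝ᵥ (((a : ℂ) • Pk n M) *ᵥ v) = (((a * (n : ℝ) ^ d * nsq (Q *ᵥ v)) : ℝ) : ℂ) := by
    rw [Matrix.smul_mulVec, dotProduct_smul, smul_eq_mul, Pk, Matrix.smul_mulVec, dotProduct_smul,
      smul_eq_mul, ← Matrix.mulVec_mulVec, Matrix.dotProduct_mulVec, Matrix.vecMul_conjTranspose,
      star_star, ← hQdef, star_dotProduct_self, eN]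
    push_cast
    ring
  have h3 : a * (n : ℝ) ^ d * nsq (Q *ᵥ v) ≤ t := by
    have h := re_form_le_of_sub_posSemidef (calDa_sub_smul_Pk_posSemidef n hn M a ha) v
    rw [← hDdef, hPk, Complex.ofReal_re] at h
    exact h
  -- Cauchy–Schwarz: `t ≤ ‖w‖ ‖Qv‖`
  have h4 : t ≤ Real.sqrt (nsq w) * Real.sqrt (nsq (Q *ᵥ v)) := by
    have h := norm_star_dotProduct_le w (Q *ᵥ v)
    rw [hform] at h
    exact (Complex.re_le_norm _).trans h
  -- combine
  have h5 : a * (n : ℝ) ^ d * t ^ 2 ≤ nsq w * t := by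
    have hsq : t ^ 2 ≤ nsq w * nsq (Q *ᵥ v) := by
      have := pow_le_pow_left₀ ht0 h4 2
      rwa [mul_pow, Real.sq_sqrt (nsq_nonneg _), Real.sq_sqrt (nsq_nonneg _)] at this
    calc a * (n : ℝ) ^ d * t ^ 2 ≤ a * (n : ℝ) ^ d * (nsq w * nsq (Q *ᵥ v)) :=
          mul_le_mul_of_nonneg_left hsq (by positivity)
      _ = nsq w * (a * (n : ℝ) ^ d * nsq (Q *ᵥ v)) := by ring
      _ ≤ nsq w * t := mul_le_mul_of_nonneg_left h3 (nsq_nonneg _)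
  have h6 : (n : ℝ) ^ d * t ≤ a⁻¹ * nsq w := by
    rcases ht0.eq_or_lt with ht | ht
    · rw [← ht, mul_zero]; exact mul_nonneg (inv_nonneg.mpr ha.le) (nsq_nonneg _)
    · have h7 : a * (n : ℝ) ^ d * t ≤ nsq w := by
        have := h5
        rw [pow_two, ← mul_assoc] at this
        exact le_of_mul_le_mul_right this ht
      calc (n : ℝ) ^ d * t = a⁻¹ * (a * (n : ℝ) ^ d * t) := by
            rw [← mul_assoc, ← mul_assoc, inv_mul_cancel₀ ha.ne', one_mul]
        _ ≤ a⁻¹ * nsq w := mul_le_mul_of_nonneg_left h7 (inv_nonneg.mpr ha.le)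
  rw [h1, eN, Complex.re_ofReal_mul]
  exact h6

/-- **`‖Q_k G Q_k^*‖ ≤ a⁻¹`** at `U = 1`, every level, every torus, every `a > 0` — so King's (2.14)
operator for `Δ_a` is `≥ 0`. [cite: Balaban1984PropagatorsI, p.30, (1.71) p.30 (bound ours)] -/
theorem opNorm_covB_le : ‖covB n hn M a ha‖ ≤ a⁻¹ :=
  opNorm_le_of_re_form_le (covB_posSemidef n hn M a ha) (inv_nonneg.mpr ha.le)
    (re_form_covB_le n hn M a ha)

end Objects



/-! ## §6 Zero modes: `x`-constant vector fields; `‖Q_k𝒢Q_k^*‖ = a⁻¹`; the effective operator -/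

section ZeroModes

variable {d : ℕ} (n : ℕ) [NeZero n] (hn : 1 ≤ n) (M : Fin d → ℕ) [hM : ∀ μ, NeZero (M μ)]
  (a : ℝ) (ha : 0 < a)

/-- `Q_k` of an `x`-constant vector field `(x, μ) ↦ c_μ` is the same constant on the unit lattice ((1.18)
averages `n^{d+1}` values with weight `η^{d+1}`; cf. «a⟨1, Q^*QA_μ⟩ = a⟨1, A_μ⟩» in (1.74)).
[cite: Balaban1984PropagatorsI, (1.18) p.20, (1.74) p.30] -/
theorem QvOp_mulVec_const (c : Fin d → ℂ) :
    QvOp n M *ᵥ (fun i : Tor (fine n M) × Fin d => c i.2) = fun b => c b.2 := by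
  have hnc : (n : ℂ) ≠ 0 := by exact_mod_cast NeZero.ne n
  funext ⟨y, μ⟩
  rw [QvOp_mulVec]
  simp only [lineSum, Finset.sum_const, Finset.card_univ, Fintype.card_fin, Fintype.card_pi,
    Finset.prod_const, nsmul_eq_mul]
  push_cast
  rw [pow_succ]
  field_simp

omit [NeZero n] hM in
/-- off-component entries of `Q_k` vanish. [folklore] -/
private theorem QvOp_apply_of_ne {μ ν : Fin d} (h : ν ≠ μ) (y : Tor M) (x : Tor (fine n M)) :
    QvOp n M (y, μ) (x, ν) = 0 := by
  simp only [QvOp, if_neg h]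

/-- the COLUMN SUMS of `Q_k`: every fine bond `[x, x+e_ν]` lies on exactly `n` of the contours of (1.18)
(one per offset `t`, each inside exactly one block, `sum_blocks`): `Σ_y (Q_k)_{(y,ν),(x,ν)} = η^d`.
[cite: Balaban1984PropagatorsI, (1.18) p.20 (count ours)] -/
theorem QvOp_colSum (x : Tor (fine n M)) (ν : Fin d) :
    ∑ y : Tor M, QvOp n M (y, ν) (x, ν) = (((n : ℂ) ^ d))⁻¹ := by
  have hnc : (n : ℂ) ≠ 0 := by exact_mod_cast NeZero.ne n
  simp only [QvOp, if_true]
  set F : Tor (fine n M) → ℂ := fun x' => ∑ t : Fin n,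
    if x = x' + tstep (fine n M) ν t then 1 / (n : ℂ) ^ (d + 1) else 0 with hF
  rw [show (∑ y : Tor M, ∑ j : Fin d → Fin n, ∑ t : Fin n,
      if x = bpt n M y j + tstep (fine n M) ν t then 1 / (n : ℂ) ^ (d + 1) else 0)
      = ∑ y : Tor M, ∑ j : Fin d → Fin n, F (bpt n M y j) from rfl, ← sum_blocks n M F]
  simp only [hF]
  rw [Finset.sum_comm]
  have hc : ∀ (t : Fin n) (x' : Tor (fine n M)),
      (x = x' + tstep (fine n M) ν t) ↔ (x - tstep (fine n M) ν t = x') := by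
    intro t x'
    constructor
    · intro h; rw [h, add_sub_cancel_right]
    · intro h; rw [← h, sub_add_cancel]
  simp only [hc, Finset.sum_ite_eq, Finset.mem_univ, if_true, Finset.sum_const, Finset.card_univ,
    Fintype.card_fin, nsmul_eq_mul]
  rw [pow_succ]
  field_simp

/-- `Q_kᵀ` spreads an `x`-constant unit-lattice field with the factor `η^d`, i.e. the adjoint
`Q_k^* = η^{-d}Q_kᵀ` FIXES constants («a⟨1, Q^*QA_μ⟩ = a⟨1, A_μ⟩», (1.74)). [cite: Balaban1984PropagatorsI, (1.74) p.30] -/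
theorem QvOp_conjTranspose_mulVec_const (c : Fin d → ℂ) :
    (QvOp n M)ᴴ *ᵥ (fun b : Tor M × Fin d => c b.2)
      = fun i => (((n : ℂ) ^ d))⁻¹ * c i.2 := by
  funext ⟨x, ν⟩
  rw [Matrix.mulVec_conjTranspose]
  simp only [Pi.star_apply, Matrix.vecMul, dotProduct, Fintype.sum_prod_type]
  have inner : ∀ y : Tor M, (∑ μ : Fin d, star (c μ) * QvOp n M (y, μ) (x, ν))
      = star (c ν) * QvOp n M (y, ν) (x, ν) := by
    intro y
    rw [Finset.sum_eq_single_of_mem ν (Finset.mem_univ _)]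
    intro μ _ hμ
    rw [QvOp_apply_of_ne n M (Ne.symm hμ), mul_zero]
  simp_rw [inner]
  rw [← Finset.mul_sum, QvOp_colSum, star_mul', star_star, star_inv₀, star_pow, Complex.star_def,
    Complex.conj_natCast, mul_comm]

/-- the componentwise DFT of an `x`-constant vector field is supported on the zero momentum:
`F(c_μ)(p, μ) = √|T|·c_μ·[p = 0]`. [folklore] -/
private theorem dftV_mulVec_const (N : Fin d → ℕ) [∀ μ, NeZero (N μ)] (c : Fin d → ℂ) :
    dftV N *ᵥ (fun j : Tor N × Fin d => c j.2)
      = fun i => if i.1 = 0 then ((Real.sqrt (Fintype.card (Tor N)) : ℝ) : ℂ) * c i.2 else 0 := by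
  classical
  funext i
  rw [Matrix.mulVec, dotProduct, Fintype.sum_prod_type]
  simp_rw [show ∀ (x : Tor N) (μ' : Fin d), dftV N i (x, μ') = dftV N (i.1, i.2) (x, μ')
    from fun _ _ => rfl, dftV_apply]
  simp_rw [ite_mul, zero_mul, Finset.sum_ite_eq, Finset.mem_univ, if_true]
  simp only [dft]
  rw [← Finset.sum_mul, ← Finset.mul_sum, ← map_sum, sum_chi]
  have hcard : (0 : ℝ) < Fintype.card (Tor N) := by exact_mod_cast Fintype.card_pos
  by_cases hi : i.1 = 0
  · rw [if_pos hi, if_pos hi, map_natCast]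
    congr 1
    have e : ((Fintype.card (Tor N) : ℕ) : ℂ)
        = (((Real.sqrt (Fintype.card (Tor N)) * Real.sqrt (Fintype.card (Tor N)) : ℝ)) : ℂ) := by
      rw [Real.mul_self_sqrt hcard.le]; push_cast; rfl
    rw [e]; push_cast
    rw [inv_mul_cancel_left₀]
    exact_mod_cast (Real.sqrt_pos.mpr hcard).ne'
  · rw [if_neg hi, if_neg hi, map_zero, mul_zero, zero_mul]

/-- `blockEquiv` sends the zero momentum to the offset `l = 0` over the coarse class `q = 0`.
[folklore] -/
private theorem blockEquiv_zero (μ : Fin d) :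
    blockEquiv n M ((0 : Tor (fine n M)), μ) = (((fun _ => (0 : Fin n)), μ), (0 : Tor M)) := by
  rw [Equiv.apply_eq_iff_eq_symm_apply, blockEquiv_symm_apply]
  refine Prod.ext (funext fun ν => ?_) rfl
  simp [B5Prop11Plancherel.emb]

/-- the zero-momentum columns of `Ĝ`: the diagonal block `G₀` with entry `a⁻¹` at `l = 0`.
[folklore] -/
private theorem calGhat_apply_zero (i : Tor (fine n M) × Fin d) (μ' : Fin d) :
    calGhat n hn M a ha i ((0 : Tor (fine n M)), μ')
      = if i = ((0 : Tor (fine n M)), μ') then ((a : ℂ))⁻¹ else 0 := by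
  classical
  have key : calGhat n hn M a ha i ((0 : Tor (fine n M)), μ')
      = Matrix.blockDiagonal (blocks n hn M a ha) (blockEquiv n M i)
          (blockEquiv n M ((0 : Tor (fine n M)), μ')) := by
    simp [calGhat, Matrix.reindex_apply, Matrix.submatrix_apply]
  rw [key, blockEquiv_zero, Matrix.blockDiagonal_apply]
  by_cases hi : i = ((0 : Tor (fine n M)), μ')
  · subst hi
    rw [blockEquiv_zero, if_pos rfl, if_pos rfl]
    simp only [blocks, dif_pos, G₀]
    rw [Matrix.diagonal_apply_eq, if_pos rfl, one_div]
  · rw [if_neg hi]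
    have hne : blockEquiv n M i ≠ (((fun _ => (0 : Fin n)), μ'), (0 : Tor M)) := by
      intro h
      apply hi
      rw [← blockEquiv_zero (M := M) n μ'] at h
      exact (blockEquiv n M).injective h
    by_cases h2 : (blockEquiv n M i).2 = (0 : Tor M)
    · rw [if_pos h2]
      simp only [blocks, h2, dif_pos, G₀]
      rw [Matrix.diagonal_apply_ne]
      intro h1
      apply hne
      exact Prod.ext h1 h2
    · rw [if_neg h2]

/-- «GJ = GJ′ + a⁻¹J₀. (1.82)» at `U = 1`: `G` multiplies every `x`-constant vector field by `a⁻¹` (the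
`p = 0` fibre of (1.83); cf. `Ã_μ(0) = a⁻¹J̃_μ(0)` below (1.74)). [cite: Balaban1984PropagatorsI, (1.82) p.31, (1.74) p.30] -/
theorem calG_mulVec_const (c : Fin d → ℂ) :
    calG n hn M a ha *ᵥ (fun j : Tor (fine n M) × Fin d => c j.2)
      = ((a : ℂ))⁻¹ • (fun j : Tor (fine n M) × Fin d => c j.2) := by
  classical
  set g : Tor (fine n M) × Fin d → ℂ := fun j => c j.2 with hg
  have h1 := dftV_mulVec_const (fine n M) c
  set s : ℂ := (((Real.sqrt (Fintype.card (Tor (fine n M))) : ℝ)) : ℂ) with hs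
  have h2 : calGhat n hn M a ha *ᵥ (dftV (fine n M) *ᵥ g)
      = ((a : ℂ))⁻¹ • (dftV (fine n M) *ᵥ g) := by
    rw [hg, h1]
    funext i
    rw [Matrix.mulVec, dotProduct, Pi.smul_apply, smul_eq_mul, Fintype.sum_prod_type]
    have inner : ∀ p : Tor (fine n M), (∑ μ' : Fin d, calGhat n hn M a ha i (p, μ') *
        (if ((p, μ') : Tor (fine n M) × Fin d).1 = 0 then
          s * c ((p, μ') : Tor (fine n M) × Fin d).2 else 0))
        = if p = 0 then ∑ μ' : Fin d, calGhat n hn M a ha i (0, μ') * (s * c μ') else 0 := by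
      intro p
      by_cases hp : p = 0
      · subst hp; simp
      · simp [hp]
    simp_rw [inner]
    rw [Finset.sum_ite_eq', if_pos (Finset.mem_univ _)]
    simp_rw [calGhat_apply_zero, ite_mul, zero_mul]
    by_cases hi : i.1 = 0
    · have : ∀ μ' : Fin d, (i = ((0 : Tor (fine n M)), μ')) ↔ (μ' = i.2) := by
        intro μ'
        constructor
        · intro h; rw [h]
        · intro h; rw [h]; exact Prod.ext hi rfl
      simp_rw [this]
      rw [Finset.sum_ite_eq' Finset.univ i.2, if_pos (Finset.mem_univ _), if_pos hi]
    · have : ∀ μ' : Fin d, ¬ (i = ((0 : Tor (fine n M)), μ')) := by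
        intro μ' h; apply hi; rw [h]
      simp_rw [if_neg (this _)]
      rw [Finset.sum_const_zero, if_neg hi, mul_zero]
  calc calG n hn M a ha *ᵥ g
      = star (dftV (fine n M)) *ᵥ (calGhat n hn M a ha *ᵥ (dftV (fine n M) *ᵥ g)) := by
        rw [calG, ← Matrix.mulVec_mulVec, ← Matrix.mulVec_mulVec]
    _ = ((a : ℂ))⁻¹ • ((star (dftV (fine n M)) * dftV (fine n M)) *ᵥ g) := by
        rw [h2, Matrix.mulVec_smul, Matrix.mulVec_mulVec]
    _ = ((a : ℂ))⁻¹ • g := by rw [star_dftV_mul, Matrix.one_mulVec]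

/-- **`(Q_kGQ_k^*)c = a⁻¹c`** on `x`-constant unit-lattice vector fields, at every level.
[cite: Balaban1984PropagatorsI, (1.82) p.31, (1.74) p.30 (corollary ours)] -/
theorem covB_mulVec_const (c : Fin d → ℂ) :
    covB n hn M a ha *ᵥ (fun b : Tor M × Fin d => c b.2)
      = ((a : ℂ))⁻¹ • (fun b : Tor M × Fin d => c b.2) := by
  have hn0 : ((n : ℂ) ^ d) ≠ 0 := pow_ne_zero _ (by exact_mod_cast NeZero.ne n)
  have hQH : (QvOp n M)ᴴ *ᵥ (fun b : Tor M × Fin d => c b.2)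
      = (((n : ℂ) ^ d))⁻¹ • (fun i : Tor (fine n M) × Fin d => c i.2) := by
    rw [QvOp_conjTranspose_mulVec_const]; rfl
  rw [covB, Matrix.smul_mulVec, ← Matrix.mulVec_mulVec, ← Matrix.mulVec_mulVec, hQH,
    Matrix.mulVec_smul, calG_mulVec_const, Matrix.mulVec_smul, Matrix.mulVec_smul,
    QvOp_mulVec_const, smul_smul, smul_smul, mul_inv_cancel₀ hn0, one_mul]

/-- `a⁻¹ ≤ ‖Q_kGQ_k^*‖` (`d ≥ 1`; witness: a constant field). [cite: Balaban1984PropagatorsI, (1.82) p.31 (corollary ours)] -/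
theorem inv_le_opNorm_covB (hd : 0 < d) : a⁻¹ ≤ ‖covB n hn M a ha‖ := by
  classical
  set μ₀ : Fin d := ⟨0, hd⟩ with hμ₀
  set c : Fin d → ℂ := fun μ => if μ = μ₀ then 1 else 0 with hc
  set f : Tor M × Fin d → ℂ := fun i => c i.2 with hf
  have hev := covB_mulVec_const n hn M a ha c
  have h1 := nsq_mulVec_le (covB n hn M a ha) f
  rw [hf, hev] at h1
  have hnsq : nsq (((a : ℂ))⁻¹ • fun i : Tor M × Fin d => c i.2)
      = (a⁻¹) ^ 2 * nsq (fun i : Tor M × Fin d => c i.2) := by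
    simp only [nsq, Pi.smul_apply, smul_eq_mul, norm_mul, mul_pow, Finset.mul_sum]
    congr 1; funext i
    rw [norm_inv, Complex.norm_real, Real.norm_of_nonneg ha.le]
  rw [hnsq] at h1
  have hpos : 0 < nsq (fun i : Tor M × Fin d => c i.2) := by
    have hle : ‖(fun i : Tor M × Fin d => c i.2) ((0 : Tor M), μ₀)‖ ^ 2
        ≤ nsq (fun i : Tor M × Fin d => c i.2) :=
      Finset.single_le_sum (f := fun i => ‖(fun i : Tor M × Fin d => c i.2) i‖ ^ 2)
        (fun i _ => sq_nonneg _) (Finset.mem_univ _)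
    have h1' : ‖(fun i : Tor M × Fin d => c i.2) ((0 : Tor M), μ₀)‖ ^ 2 = 1 := by
      simp [hc]
    linarith
  have h2 : (a⁻¹) ^ 2 ≤ ‖covB n hn M a ha‖ ^ 2 := le_of_mul_le_mul_right h1 hpos
  exact (pow_le_pow_iff_left₀ (inv_nonneg.mpr ha.le) (norm_nonneg _) two_ne_zero).mp h2

/-- **`‖Q_k G Q_k^*‖ = a⁻¹` EXACTLY** (`d ≥ 1`, `U = 1`, every level / torus / `a > 0`).
[cite: Balaban1984PropagatorsI, p.30, (1.71) p.30, (1.82) p.31 (equality ours)] -/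
theorem opNorm_covB_eq (hd : 0 < d) : ‖covB n hn M a ha‖ = a⁻¹ :=
  le_antisymm (opNorm_covB_le n hn M a ha) (inv_le_opNorm_covB n hn M a ha hd)

/-- `a − a²Q_kGQ_k^*` is Hermitian. [cite: King1986, (2.14) p.653] -/
theorem effOp_isHermitian : (effOp n hn M a ha).IsHermitian := by
  have hc := (covB_isHermitian n hn M a ha).eq
  unfold Matrix.IsHermitian effOp
  rw [Matrix.conjTranspose_sub, Matrix.conjTranspose_smul, Matrix.conjTranspose_smul,
    Matrix.conjTranspose_one, hc]
  have h1 : star (a : ℂ) = (a : ℂ) := by rw [Complex.star_def, Complex.conj_ofReal]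
  have h2 : star ((a : ℂ) ^ 2) = (a : ℂ) ^ 2 := by rw [star_pow, h1]
  rw [h1, h2]

/-- **`a − a²Q_kGQ_k^* ≥ 0`** for Bałaban's `Δ_a`, unconditionally (from `‖Q_kGQ_k^*‖ ≤ a⁻¹`).
[cite: King1986, (2.14) p.653 (for Bałaban's Δ_a (1.69); positivity ours)] -/
theorem effOp_posSemidef : (effOp n hn M a ha).PosSemidef := by
  refine Matrix.PosSemidef.of_dotProduct_mulVec_nonneg (effOp_isHermitian n hn M a ha) fun x => ?_
  set c := covB n hn M a ha with hcdef
  have hcp : c.PosSemidef := covB_posSemidef n hn M a ha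
  have hform : star x ⬝ᵥ (effOp n hn M a ha *ᵥ x)
      = (a : ℂ) * (star x ⬝ᵥ x) - (a : ℂ) ^ 2 * (star x ⬝ᵥ (c *ᵥ x)) := by
    unfold effOp
    rw [Matrix.sub_mulVec, Matrix.smul_mulVec, Matrix.smul_mulVec, Matrix.one_mulVec,
      dotProduct_sub, dotProduct_smul, dotProduct_smul, smul_eq_mul, smul_eq_mul]
  have ht := form_eq_re_of_posSemidef hcp x
  set t := (star x ⬝ᵥ (c *ᵥ x)).re with htdef
  have htle : t ≤ a⁻¹ * nsq x := re_form_covB_le n hn M a ha x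
  have hval : star x ⬝ᵥ (effOp n hn M a ha *ᵥ x) = ((a * nsq x - a ^ 2 * t : ℝ) : ℂ) := by
    rw [hform, star_dotProduct_self, ht]
    push_cast
    ring
  rw [hval]
  apply Complex.zero_le_real.mpr
  have hn0 := nsq_nonneg x
  have : a ^ 2 * t ≤ a ^ 2 * (a⁻¹ * nsq x) := mul_le_mul_of_nonneg_left htle (sq_nonneg a)
  have e2 : a ^ 2 * (a⁻¹ * nsq x) = a * nsq x := by
    rw [← mul_assoc, pow_two, mul_assoc a a a⁻¹, mul_inv_cancel₀ ha.ne', mul_one]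
  linarith

/-- `a − a²Q_kGQ_k^* ≤ a·1`. [cite: King1986, (2.14) p.653 (bound ours)] -/
theorem smul_one_sub_effOp_posSemidef :
    ((a : ℂ) • (1 : Matrix (Tor M × Fin d) (Tor M × Fin d) ℂ) - effOp n hn M a ha).PosSemidef := by
  have e : (a : ℂ) • (1 : Matrix (Tor M × Fin d) (Tor M × Fin d) ℂ) - effOp n hn M a ha
      = ((a ^ 2 : ℝ) : ℂ) • covB n hn M a ha := by
    unfold effOp
    push_cast
    exact sub_sub_cancel _ _
  rw [e]
  exact posSemidef_real_smul (covB_posSemidef n hn M a ha) (sq_nonneg a)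

/-- ZERO MODES: `(a − a²Q_kGQ_k^*)c = 0` for every `x`-constant unit-lattice vector field — the bound
`‖Q_kGQ_k^*‖ ≤ a⁻¹` is attained. [cite: King1986, (2.14) p.653 (for Bałaban's Δ_a; zero modes ours from (1.82) p.31)] -/
theorem effOp_mulVec_const (c : Fin d → ℂ) :
    effOp n hn M a ha *ᵥ (fun b : Tor M × Fin d => c b.2) = 0 := by
  have ha0 : (a : ℂ) ≠ 0 := by exact_mod_cast ha.ne'
  unfold effOp
  rw [Matrix.sub_mulVec, Matrix.smul_mulVec, Matrix.smul_mulVec, Matrix.one_mulVec,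
    covB_mulVec_const, smul_smul, pow_two, mul_assoc, mul_inv_cancel₀ ha0, mul_one, sub_self]

end ZeroModes


/-! ## §7 King's mechanism (2.13) → (2.14) for `Δ_a`: completing the square in the soft-averaging
Gaussian exponent -/

section CompleteSquare

variable {d : ℕ} (n : ℕ) [NeZero n] (hn : 1 ≤ n) (M : Fin d → ℕ) [hM : ∀ μ, NeZero (M μ)]
  (a : ℝ) (ha : 0 < a)

/-- `x^*(Pᴴ y) = (P x)^* y`. [folklore] -/
private theorem adjL {m k : Type*} [Fintype m] [Fintype k] (P : Matrix m k ℂ) (x : k → ℂ)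
    (y : m → ℂ) : star x ⬝ᵥ (Pᴴ *ᵥ y) = star (P *ᵥ x) ⬝ᵥ y := by
  rw [Matrix.dotProduct_mulVec, Matrix.vecMul_conjTranspose, star_star]

/-- `y^*(P x) = (Pᴴ y)^* x`. [folklore] -/
private theorem adjR {m k : Type*} [Fintype m] [Fintype k] (P : Matrix m k ℂ) (y : m → ℂ)
    (x : k → ℂ) : star y ⬝ᵥ (P *ᵥ x) = star (Pᴴ *ᵥ y) ⬝ᵥ x := by
  have h := adjL Pᴴ y x
  rwa [Matrix.conjTranspose_conjTranspose] at h

/-- the minimiser of the soft-averaging exponent at fixed unit-lattice field `B`: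
`A_B := a·η^{-d}·G Q_kᵀ B = a·G Q_k^* B`. [cite: King1986, (2.13)-(2.14) p.653 (for Bałaban's Δ_a (1.69); construction ours)] -/
noncomputable def Amin (B : Tor M × Fin d → ℂ) : Tor (fine n M) × Fin d → ℂ :=
  ((a : ℂ) * (n : ℂ) ^ d) • (calG n hn M a ha *ᵥ ((QvOp n M)ᴴ *ᵥ B))

/-- `𝒟_a A_B = a·η^{-d}·Q_kᵀB` («Δ_a⁻¹ = G_k, or simply G. (1.71)»). [cite: Balaban1984PropagatorsI, (1.71) p.30] -/
theorem calDa_mulVec_Amin (B : Tor M × Fin d → ℂ) :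
    calDa n hn M a ha *ᵥ Amin n hn M a ha B
      = ((a : ℂ) * (n : ℂ) ^ d) • ((QvOp n M)ᴴ *ᵥ B) := by
  rw [Amin, Matrix.mulVec_smul, Matrix.mulVec_mulVec, calDa_mul_calG, Matrix.one_mulVec]

/-- `Q_k A_B = a·(Q_kGQ_k^*)B`. [cite: Balaban1984PropagatorsI, (1.71) p.30] -/
theorem QvOp_mulVec_Amin (B : Tor M × Fin d → ℂ) :
    QvOp n M *ᵥ Amin n hn M a ha B = (a : ℂ) • (covB n hn M a ha *ᵥ B) := by
  rw [Amin, Matrix.mulVec_smul, covB, Matrix.smul_mulVec, ← Matrix.mulVec_mulVec,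
    ← Matrix.mulVec_mulVec, smul_smul]

/-- COMPLETING THE SQUARE (King's step from (2.13) to (2.14), here for Bałaban's `Δ_a` and `Q_k`):
`(A − A_B)^*𝒟_a(A − A_B) = A^*𝒟_aA − aη^{-d}((Q_kA)^*B + B^*Q_kA) + a²η^{-d}·B^*(Q_kGQ_k^*)B`.
[cite: King1986, (2.13)-(2.14) p.653 (for Bałaban's Δ_a (1.69), Q_k (1.18); identity ours)] -/
theorem form_calDa_sub_Amin (A : Tor (fine n M) × Fin d → ℂ) (B : Tor M × Fin d → ℂ) :
    star (A - Amin n hn M a ha B) ⬝ᵥ (calDa n hn M a ha *ᵥ (A - Amin n hn M a ha B))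
      = star A ⬝ᵥ (calDa n hn M a ha *ᵥ A)
        - ((a : ℂ) * (n : ℂ) ^ d) * (star (QvOp n M *ᵥ A) ⬝ᵥ B + star B ⬝ᵥ (QvOp n M *ᵥ A))
        + ((a : ℂ) ^ 2 * (n : ℂ) ^ d) * (star B ⬝ᵥ (covB n hn M a ha *ᵥ B)) := by
  have hDH : (calDa n hn M a ha)ᴴ = calDa n hn M a ha := (calDa_isHermitian n hn M a ha).eq
  have hcH : (covB n hn M a ha)ᴴ = covB n hn M a ha := (covB_isHermitian n hn M a ha).eq
  have hreal : star ((a : ℂ) * (n : ℂ) ^ d) = (a : ℂ) * (n : ℂ) ^ d := by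
    rw [star_mul', star_pow, Complex.star_def, Complex.conj_ofReal, Complex.conj_natCast]
  have ha' : star (a : ℂ) = (a : ℂ) := by rw [Complex.star_def, Complex.conj_ofReal]
  have h1 := calDa_mulVec_Amin n hn M a ha B
  -- cross term 1
  have h2 : star A ⬝ᵥ (calDa n hn M a ha *ᵥ Amin n hn M a ha B)
      = ((a : ℂ) * (n : ℂ) ^ d) * (star (QvOp n M *ᵥ A) ⬝ᵥ B) := by
    rw [h1, dotProduct_smul, smul_eq_mul, adjL]
  -- cross term 2
  have h3 : star (Amin n hn M a ha B) ⬝ᵥ (calDa n hn M a ha *ᵥ A)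
      = ((a : ℂ) * (n : ℂ) ^ d) * (star B ⬝ᵥ (QvOp n M *ᵥ A)) := by
    rw [adjR, hDH, h1, star_smul, smul_dotProduct, smul_eq_mul, hreal, ← adjR]
  -- square term
  have h4 : star (Amin n hn M a ha B) ⬝ᵥ (calDa n hn M a ha *ᵥ Amin n hn M a ha B)
      = ((a : ℂ) ^ 2 * (n : ℂ) ^ d) * (star B ⬝ᵥ (covB n hn M a ha *ᵥ B)) := by
    rw [h1, dotProduct_smul, smul_eq_mul, adjL, QvOp_mulVec_Amin, star_smul, smul_dotProduct,
      smul_eq_mul, ha', ← hcH, ← adjR, hcH]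
    ring
  rw [Matrix.mulVec_sub, star_sub, sub_dotProduct, dotProduct_sub, dotProduct_sub, h2, h3, h4]
  ring

/-- KING'S (2.13) → (2.14) FOR BAŁABAN'S `Δ_a`, as an identity of quadratic forms: for all `A`, `B`,
`½η^d·A^*𝒟_aA − (a/2)((Q_kA)^*B + B^*Q_kA) + (a/2)B^*B`
`= ½B^*(a − a²Q_kGQ_k^*)B + ½η^d(A − A_B)^*𝒟_a(A − A_B)` — the exponent
`½⟨A, Δ_aA⟩ − a Re⟨B, Q_kA⟩ + ½a‖B‖² = ½⟨A,(Δ − ∂P∂^*)A⟩ + ½a‖B − Q_kA‖²` of a SOFT (Gaussian-weight)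
averaging equals its minimum `½⟨B,(a − a²Q_kGQ_k^*)B⟩` plus a `𝒟_a`-square.
[cite: King1986, (2.13)-(2.14) p.653 (for Bałaban's Δ_a (1.69), Q_k (1.18); identity ours)] -/
theorem completeSquare (A : Tor (fine n M) × Fin d → ℂ) (B : Tor M × Fin d → ℂ) :
    (1 / 2 : ℂ) * (((n : ℂ) ^ d))⁻¹ * (star A ⬝ᵥ (calDa n hn M a ha *ᵥ A))
      - ((a : ℂ) / 2) * (star (QvOp n M *ᵥ A) ⬝ᵥ B + star B ⬝ᵥ (QvOp n M *ᵥ A))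
      + ((a : ℂ) / 2) * (star B ⬝ᵥ B)
    = (1 / 2 : ℂ) * (star B ⬝ᵥ (effOp n hn M a ha *ᵥ B))
      + (1 / 2 : ℂ) * (((n : ℂ) ^ d))⁻¹ *
        (star (A - Amin n hn M a ha B) ⬝ᵥ (calDa n hn M a ha *ᵥ (A - Amin n hn M a ha B))) := by
  have hn0 : ((n : ℂ) ^ d) ≠ 0 := pow_ne_zero _ (by exact_mod_cast NeZero.ne n)
  have heff : star B ⬝ᵥ (effOp n hn M a ha *ᵥ B)
      = (a : ℂ) * (star B ⬝ᵥ B) - (a : ℂ) ^ 2 * (star B ⬝ᵥ (covB n hn M a ha *ᵥ B)) := by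
    unfold effOp
    rw [Matrix.sub_mulVec, Matrix.smul_mulVec, Matrix.smul_mulVec, Matrix.one_mulVec,
      dotProduct_sub, dotProduct_smul, dotProduct_smul, smul_eq_mul, smul_eq_mul]
  rw [form_calDa_sub_Amin, heff]
  field_simp
  ring

/-- hence `½⟨B,(a − a²Q_kGQ_k^*)B⟩ ≤ ½η^d⟨A,𝒟_aA⟩ − a·Re⟨B, Q_kA⟩ + (a/2)‖B‖²` for every `A` (equality at
`A = A_B`), by `𝒟_a ≥ 0`. [cite: King1986, (2.13)-(2.14) p.653 (for Bałaban's Δ_a (1.69); bound ours)] -/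
theorem half_form_effOp_le (A : Tor (fine n M) × Fin d → ℂ) (B : Tor M × Fin d → ℂ) :
    (1 / 2 : ℝ) * (star B ⬝ᵥ (effOp n hn M a ha *ᵥ B)).re
      ≤ (1 / 2 : ℝ) * (((n : ℝ) ^ d))⁻¹ * (star A ⬝ᵥ (calDa n hn M a ha *ᵥ A)).re
        - a * (star B ⬝ᵥ (QvOp n M *ᵥ A)).re + (a / 2) * nsq B := by
  have hid := completeSquare n hn M a ha A B
  have hsq : 0 ≤ (star (A - Amin n hn M a ha B) ⬝ᵥ
      (calDa n hn M a ha *ᵥ (A - Amin n hn M a ha B))).re :=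
    form_re_nonneg_of_posSemidef (calDa_posSemidef n hn M a ha) _
  have hcross : (star (QvOp n M *ᵥ A) ⬝ᵥ B).re = (star B ⬝ᵥ (QvOp n M *ᵥ A)).re := by
    simp only [dotProduct, Complex.re_sum, Pi.star_apply, Complex.star_def, Complex.mul_re,
      Complex.conj_re, Complex.conj_im]
    refine Finset.sum_congr rfl fun i _ => ?_
    ring
  have hBB : (star B ⬝ᵥ B) = ((nsq B : ℝ) : ℂ) := star_dotProduct_self B
  have e1 : (1 / 2 : ℂ) * (((n : ℂ) ^ d))⁻¹ = ((((1 / 2 : ℝ) * ((n : ℝ) ^ d)⁻¹ : ℝ)) : ℂ) := by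
    push_cast; ring
  have e2 : ((a : ℂ) / 2) = (((a / 2 : ℝ)) : ℂ) := by push_cast; ring
  have e3 : (1 / 2 : ℂ) = (((1 / 2 : ℝ)) : ℂ) := by push_cast; ring
  rw [e1, e2, hBB, e3] at hid
  have hre := congrArg Complex.re hid
  simp only [Complex.add_re, Complex.sub_re, Complex.re_ofReal_mul, Complex.ofReal_re,
    hcross] at hre
  have hpos : 0 ≤ (((n : ℝ) ^ d))⁻¹ := inv_nonneg.mpr (pow_nonneg (Nat.cast_nonneg n) d)
  nlinarith [hre, hsq, hpos, mul_nonneg hpos hsq]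

end CompleteSquare


end Literature.MathematicalPhysics.QuantumFieldTheory.Balaban1983to89.B5QGQ171Unit

end
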